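import Literature.NumberTheory.Automorphic.UnitaryGroupTruncatedTraceClassElliptic
import Literature.NumberTheory.Automorphic.UnitaryGroupKernelClassEllipticFiniteTwo
import Literature.NumberTheory.Automorphic.AdelicUnitaryGroupUnimodularQuasiSplit
import HarnessLib

/-!
# The elliptic terms of Arthur's coarse expansion for `U(J₂)` ARE orbital integrals — unconditionally
# (the `N = 2` twin of ★ `UnitaryGroupTruncatedTraceClassElliptic`)

(Rogawski, *Automorphic Representations of Unitary Groups in Three Variables* (1990), §2.2–§2.3, pp. 13–14, and
p. 98 «Let `G = U(3)`, `U(2)`, or `U(2) × U(1)`»: for an elliptic class `𝔬`,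
`J_𝔬(f) = J^T_𝔬(f) = Σ_{γ ∈ 𝔬/∼} vol(G_γ(F)\G_γ(𝔸)) · Φ(γ, f)`; Arthur, *A trace formula for reductive groups I*,
Duke Math. J. 45 (1978), §8; Gelbart (1975), (9.13) and Thm. 9.22 (ii).)

Topic `NumberTheory/Automorphic`; namespace `Literature.NumberTheory.Automorphic.UnitaryGroup`. THEOREMS ONLY
(no definition, no named fact, no instance, no notation, no `sorry`). H-side copy of LAWS 1–5 for the endoscopic
group `H = U(Φ₂) × U(Φ₁)` of the line `Cruxes/H413/Lines/F0_T1InnerFormTraceIdentity.lean` (cell hodgecm-mathlib,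
crux H413; census `CENSUS-LAWS-Hside` §3 LAW 4 «ELLIPTIC TERMS ARE ORBITAL INTEGRALS», sibling
`TruncatedTraceClassEllipticTwo`): the accepted ★ `UnitaryGroupTruncatedTraceClassElliptic` is typed for `U(J₃)`;
this file re-types its §2–§3 for `U(J₂)` (★ `quasiSplit F E c 2`; its §1 topological letters
`t2Space_quasiSplitAdelic` ∕ `isClosed_centralizer_quasiSplit` ∕ … are every-`N` and served by name). THE TRUNK
CLOSER at `N = 2`: the every-`N` unfolding ★ `truncatedTraceClass_eq_mul_tsum_covol_mul_orbitalIntegral_of_forall_ne`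
(★ `UnitaryGroupKernelClassOrbitalUnfolding`) with BOTH geometric binders discharged for the quasi-split unitary group
in two variables — the cocompactness of the elliptic centralisers (★ `compactSpace_centralizer_quotient_of_forall_cl_ne_two`,
with unimodularity ★ `isMulRightInvariant_centralizer_of_forall_cl_ne_two`) and the finiteness
`∫ Σ_{γ∈𝔬} |f(x γ x⁻¹)| dμ < ∞` (★ `lintegral_conjTsum_fiber_enorm_lt_top_two`) — so that for a test function `f`,
an automorphic measure `μ`, ANY two-sided Haar measure `ν` of `G(𝔸_F)` and ANY Haar measures `ν_s` of the
centralisers, and every class `𝔬 = cl⁻¹{i}` of a conjugation-invariant class map missing the rational Borel `B(F)`,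

  `J^T_𝔬(f) = c_μ · Σ'_{s ⊆ 𝔬} vol(G_{γ_s}(F)\G_{γ_s}(𝔸_F)) · Φ_{ν/ν_s}(γ_s, f)`   for every `T`,

`c_μ = unfoldingConstant G(F) count μ ν` (Weil's constant of `μ`). Names suffixed `_two`; no `c * c = 1` binder.

* `isInvInvariant_centralizer_of_forall_cl_ne_two` — Haar measures of elliptic centralisers of `U(J₂)` are
  inversion invariant;
* `truncatedTraceClass_eq_mul_tsum_covol_mul_orbitalIntegral_of_isQuasiSplitTest_two` — any quadratic `E/F`,
  `G(𝔸_F)` unimodular as an instance binder on `ν`;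
* **`truncatedTraceClass_eq_mul_tsum_covol_mul_orbitalIntegral_cm_two`** — the CM pair `(L⁺, L, complexConj)`:
  no hypothesis beyond the letters (`U(J₂)(𝔸_{L⁺})` is unimodular, ★ `isMulRightInvariant_quasiSplit_cm_two`).

## References
* J. D. Rogawski, *Automorphic Representations of Unitary Groups in Three Variables*, Ann. of Math. Stud.
  123 (1990), §2.2–§2.3 (pp. 13–14), §7.3 (p. 98) [Rogawski1990].
* J. Arthur, *A trace formula for reductive groups I*, Duke Math. J. 45 (1978), §8 [Arthur1978TraceFormulaI].
* S. Gelbart, *Automorphic forms on adele groups*, Ann. of Math. Stud. 83 (1975), (9.13), Thm. 9.22 (ii),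
  Remark 9.23 [Gelbart1975].
-/

set_option autoImplicit false

noncomputable section

open MeasureTheory Measure NumberField IsDedekindDomain Set Topology
open Literature.MeasureTheory.Group
open scoped NNReal ENNReal Pointwise

namespace Literature.NumberTheory.Automorphic

namespace UnitaryGroup

variable {F E : Type} [Field F] [NumberField F] [Field E] [NumberField E] [Algebra F E]
  {c : E ≃ₐ[F] E} {ι : Type*}

/-! ## §1 Inversion invariance on the elliptic centralisers of `U(J₂)` -/

section Measure

variable [MeasurableSpace (quasiSplit F E c 2).Adelic] [BorelSpace (quasiSplit F E c 2).Adelic]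

/-- **Haar measures of elliptic centralisers are inversion invariant** (`G = U(J₂)` quasi-split): for a
conjugation-invariant class map `cl`, a class `i` missing `B(F)` and `γ` of class `i`, every Haar measure `ν_Z` of
`G_γ(𝔸_F)` satisfies `ν_Z(A⁻¹) = ν_Z(A)` — `G_γ(𝔸_F)` is unimodular (★ `isMulRightInvariant_centralizer_of_forall_cl_ne_two`,
reduction theory) and a two-sided Haar measure of a second countable locally compact group is inversion invariant
(★ `isInvInvariant_of_isMulRightInvariant`). This is the last analytic binder of the Weil quotient `ν/ν_Z` carrying the
orbital integral at `γ`. [cite: Rogawski1990, §2.2 (p. 13)] -/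
theorem isInvInvariant_centralizer_of_forall_cl_ne_two
    {cl : (quasiSplit F E c 2).arithmeticSubgroup → ι} (hcl : IsConjInvariant cl) {i : ι}
    (hi : ∀ β : arithmeticBorel F E c 2, cl β ≠ i) {γ : (quasiSplit F E c 2).arithmeticSubgroup}
    (hγi : cl γ = i)
    (νZ : Measure ↥(Subgroup.centralizer ({(γ : (quasiSplit F E c 2).Adelic)} : Set (quasiSplit F E c 2).Adelic)))
    [νZ.IsHaarMeasure] : νZ.IsInvInvariant := by
  haveI := t2Space_quasiSplitAdelic (F := F) (E := E) (c := c) (N := 2)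
  haveI := locallyCompactSpace_quasiSplitAdelic (F := F) (E := E) (c := c) (N := 2)
  haveI := secondCountableTopology_quasiSplitAdelic (F := F) (E := E) (c := c) (N := 2)
  haveI : LocallyCompactSpace ↥(Subgroup.centralizer ({(γ : (quasiSplit F E c 2).Adelic)} :
      Set (quasiSplit F E c 2).Adelic)) :=
    (isClosed_centralizer_quasiSplit (γ : (quasiSplit F E c 2).Adelic)).isClosedEmbedding_subtypeVal.locallyCompactSpace
  haveI : SecondCountableTopology ↥(Subgroup.centralizer ({(γ : (quasiSplit F E c 2).Adelic)} :
      Set (quasiSplit F E c 2).Adelic)) := TopologicalSpace.Subtype.secondCountableTopology _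
  haveI := isMulRightInvariant_centralizer_of_forall_cl_ne_two hcl hi hγi νZ
  exact isInvInvariant_of_isMulRightInvariant νZ

/-! ## §2 The closer for a quadratic `E/F`: `J^T_𝔬(f) = c_μ · Σ_{s ⊆ 𝔬} covol_s · Φ_{ν/ν_s}(γ_s, f)` -/

/-- **THE ELLIPTIC TERMS ARE ORBITAL INTEGRALS — `U(J₂)` of a quadratic `E/F`, geometric binders discharged.** Let `cl` be a conjugation-invariant class map on `G(F)`, `i` a class with `cl β ≠ i` for all
`β ∈ B(F)`, `μ` an automorphic measure, `ν` a two-sided Haar measure of `G(𝔸_F)`, `rep` a section of the conjugacy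
classes of `G(F)`, `ν_s` ANY Haar measures of the centralisers `G_{γ_s}(𝔸_F)` (`γ_s = rep s`, `s ⊆ 𝔬 = cl⁻¹{i}`),
`f` a test function. Then for every `ν₀`, `𝓕`, `T`: `[g] ↦ k^T_𝔬(g⁻¹, g⁻¹)` is `μ`-integrable and
`J^T_𝔬(f) = c_μ · Σ'_{s ⊆ 𝔬} vol(G_{γ_s}(F)\G_{γ_s}(𝔸_F)) · Φ_{ν/ν_s}(γ_s, f)`. The per-class compactness is ★
`compactSpace_centralizer_quotient_of_forall_cl_ne_two`, the two-sidedness / inversion invariance of `ν_s` are ★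
`isMulRightInvariant_centralizer_of_forall_cl_ne_two` / `isInvInvariant_centralizer_of_forall_cl_ne_two`, the finiteness
is ★ `lintegral_conjTsum_fiber_enorm_lt_top_two`, the counting Haar measures and the unfolding are the every-`N` ★
`truncatedTraceClass_eq_mul_tsum_covol_mul_orbitalIntegral_of_forall_ne` (★ `UnitaryGroupKernelClassOrbitalUnfolding`).
[cite: Rogawski1990, §2.2 (p. 13)] [cite: Arthur1978TraceFormulaI, §8] [cite: Gelbart1975, (9.13) and Thm. 9.22 (ii)] -/
theorem truncatedTraceClass_eq_mul_tsum_covol_mul_orbitalIntegral_of_isQuasiSplitTest_two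
    [MeasurableSpace (adelicUnipotent F E c 2)]
    [∀ γ : (quasiSplit F E c 2).Adelic, MeasurableSpace ((quasiSplit F E c 2).Adelic ⧸
      Subgroup.centralizer ({γ} : Set (quasiSplit F E c 2).Adelic))]
    [∀ γ : (quasiSplit F E c 2).Adelic, BorelSpace ((quasiSplit F E c 2).Adelic ⧸
      Subgroup.centralizer ({γ} : Set (quasiSplit F E c 2).Adelic))]
    [∀ γ : (quasiSplit F E c 2).Adelic, MeasurableSpace (↥(Subgroup.centralizer ({γ} : Set (quasiSplit F E c 2).Adelic)) ⧸
      ((quasiSplit F E c 2).quotientSubgroup ⊓ Subgroup.centralizer ({γ} : Set (quasiSplit F E c 2).Adelic)).subgroupOf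
        (Subgroup.centralizer ({γ} : Set (quasiSplit F E c 2).Adelic)))]
    [∀ γ : (quasiSplit F E c 2).Adelic, BorelSpace (↥(Subgroup.centralizer ({γ} : Set (quasiSplit F E c 2).Adelic)) ⧸
      ((quasiSplit F E c 2).quotientSubgroup ⊓ Subgroup.centralizer ({γ} : Set (quasiSplit F E c 2).Adelic)).subgroupOf
        (Subgroup.centralizer ({γ} : Set (quasiSplit F E c 2).Adelic)))]
    (μ : Measure (quasiSplit F E c 2).automorphicQuotient) [(quasiSplit F E c 2).IsAutomorphicMeasure μ]
    (ν : Measure (quasiSplit F E c 2).Adelic) [IsHaarMeasure ν] [ν.IsMulRightInvariant]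
    {cl : (quasiSplit F E c 2).arithmeticSubgroup → ι} (hcl : IsConjInvariant cl) (i : ι)
    (rep : ConjClasses (quasiSplit F E c 2).arithmeticSubgroup → (quasiSplit F E c 2).arithmeticSubgroup)
    (hrep : ∀ s, ConjClasses.mk (rep s) = s)
    (νC : ∀ s : {s : ConjClasses (quasiSplit F E c 2).arithmeticSubgroup // cl (rep s) = i},
      Measure ↥(Subgroup.centralizer ({((rep s.1 : (quasiSplit F E c 2).arithmeticSubgroup) : (quasiSplit F E c 2).Adelic)} :
        Set (quasiSplit F E c 2).Adelic)))
    [∀ s, IsHaarMeasure (νC s)]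
    (hi : ∀ β : arithmeticBorel F E c 2, cl β ≠ i)
    {f : (quasiSplit F E c 2).Adelic → ℂ} (hf : IsQuasiSplitTest F E c 2 f)
    (ν₀ : Measure (adelicUnipotent F E c 2)) (𝓕 : Set (adelicUnipotent F E c 2)) (T : ℝ≥0) :
    haveI := t2Space_quasiSplitAdelic (F := F) (E := E) (c := c) (N := 2)
    haveI := locallyCompactSpace_quasiSplitAdelic (F := F) (E := E) (c := c) (N := 2)
    haveI := secondCountableTopology_quasiSplitAdelic (F := F) (E := E) (c := c) (N := 2)
    haveI : IsClosed (((quasiSplit F E c 2).quotientSubgroup : Set (quasiSplit F E c 2).Adelic)) :=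
      isClosed_quotientSubgroup_quasiSplit
    haveI : ∀ γ : (quasiSplit F E c 2).Adelic, IsClosed ((Subgroup.centralizer ({γ} : Set (quasiSplit F E c 2).Adelic) :
        Subgroup (quasiSplit F E c 2).Adelic) : Set (quasiSplit F E c 2).Adelic) := isClosed_centralizer_quasiSplit
    haveI : ∀ γ : (quasiSplit F E c 2).Adelic, (count : Measure ↥(((quasiSplit F E c 2).quotientSubgroup ⊓
        Subgroup.centralizer ({γ} : Set (quasiSplit F E c 2).Adelic)).subgroupOf
          (Subgroup.centralizer ({γ} : Set (quasiSplit F E c 2).Adelic)))).IsHaarMeasure :=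
      isHaarMeasure_count_inf_centralizer_subgroupOf_quasiSplit
    haveI : (count : Measure (quasiSplit F E c 2).quotientSubgroup).IsHaarMeasure :=
      isHaarMeasure_count_quotientSubgroup_quasiSplit
    haveI : ∀ s : {s : ConjClasses (quasiSplit F E c 2).arithmeticSubgroup // cl (rep s) = i},
        (νC s).IsMulRightInvariant := fun s => isMulRightInvariant_centralizer_of_forall_cl_ne_two hcl hi s.2 (νC s)
    haveI : ∀ s : {s : ConjClasses (quasiSplit F E c 2).arithmeticSubgroup // cl (rep s) = i},
        (νC s).IsInvInvariant := fun s => isInvInvariant_centralizer_of_forall_cl_ne_two hcl hi s.2 (νC s)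
    letI := AdelicGroupData.measurableSpaceQuotientForm (quasiSplit F E c 2)
    haveI := AdelicGroupData.borelSpaceQuotientForm (quasiSplit F E c 2)
    haveI := AdelicGroupData.smulInvariantMeasureQuotientForm (quasiSplit F E c 2) μ
    haveI := AdelicGroupData.isFiniteMeasureOnCompactsQuotientForm (quasiSplit F E c 2) μ
    Integrable ((quasiSplit F E c 2).quotFun (truncatedKernelClass ν₀ 𝓕 T cl i f)) μ ∧
    truncatedTraceClass μ ν₀ 𝓕 T cl i f =
      ((unfoldingConstant (quasiSplit F E c 2).quotientSubgroup (count : Measure (quasiSplit F E c 2).quotientSubgroup) μ ν : ℝ) : ℂ) *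
        ∑' s : {s : ConjClasses (quasiSplit F E c 2).arithmeticSubgroup // cl (rep s) = i},
          ((quotientMeasure (((quasiSplit F E c 2).quotientSubgroup ⊓ Subgroup.centralizer
              ({((rep s.1 : (quasiSplit F E c 2).arithmeticSubgroup) : (quasiSplit F E c 2).Adelic)} : Set (quasiSplit F E c 2).Adelic)).subgroupOf
              (Subgroup.centralizer ({((rep s.1 : (quasiSplit F E c 2).arithmeticSubgroup) : (quasiSplit F E c 2).Adelic)} : Set (quasiSplit F E c 2).Adelic)))
              count (isClosed_inf_centralizer_subgroupOf_quasiSplit _) (νC s) Set.univ).toReal : ℂ) *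
            orbitalIntegral ((rep s.1 : (quasiSplit F E c 2).arithmeticSubgroup) : (quasiSplit F E c 2).Adelic) f
              (quotientMeasure (Subgroup.centralizer ({((rep s.1 : (quasiSplit F E c 2).arithmeticSubgroup) :
                (quasiSplit F E c 2).Adelic)} : Set (quasiSplit F E c 2).Adelic)) (νC s)
                (isClosed_centralizer_quasiSplit _) ν) := by
  -- topology of `G(𝔸_F)`
  haveI := t2Space_quasiSplitAdelic (F := F) (E := E) (c := c) (N := 2)
  haveI := locallyCompactSpace_quasiSplitAdelic (F := F) (E := E) (c := c) (N := 2)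
  haveI := secondCountableTopology_quasiSplitAdelic (F := F) (E := E) (c := c) (N := 2)
  -- closedness letters and counting Haar measures (★ `UnitaryGroupKernelClassOrbitalUnfolding` §2)
  haveI hL : IsClosed (((quasiSplit F E c 2).quotientSubgroup : Set (quasiSplit F E c 2).Adelic)) :=
    isClosed_quotientSubgroup_quasiSplit
  haveI hCcl : ∀ γ : (quasiSplit F E c 2).Adelic, IsClosed ((Subgroup.centralizer ({γ} : Set (quasiSplit F E c 2).Adelic) :
      Subgroup (quasiSplit F E c 2).Adelic) : Set (quasiSplit F E c 2).Adelic) := isClosed_centralizer_quasiSplit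
  haveI : ∀ γ : (quasiSplit F E c 2).Adelic, (count : Measure ↥(((quasiSplit F E c 2).quotientSubgroup ⊓
      Subgroup.centralizer ({γ} : Set (quasiSplit F E c 2).Adelic)).subgroupOf
        (Subgroup.centralizer ({γ} : Set (quasiSplit F E c 2).Adelic)))).IsHaarMeasure :=
    isHaarMeasure_count_inf_centralizer_subgroupOf_quasiSplit
  haveI : (count : Measure (quasiSplit F E c 2).quotientSubgroup).IsHaarMeasure :=
    isHaarMeasure_count_quotientSubgroup_quasiSplit
  -- the elliptic centralisers: unimodular, inversion invariant, cocompact (★ `UnitaryGroupEllipticCentralizerCompactTwo`)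
  haveI : ∀ s : {s : ConjClasses (quasiSplit F E c 2).arithmeticSubgroup // cl (rep s) = i},
      (νC s).IsMulRightInvariant := fun s =>
    isMulRightInvariant_centralizer_of_forall_cl_ne_two hcl hi s.2 (νC s)
  haveI : ∀ s : {s : ConjClasses (quasiSplit F E c 2).arithmeticSubgroup // cl (rep s) = i},
      (νC s).IsInvInvariant := fun s =>
    isInvInvariant_centralizer_of_forall_cl_ne_two hcl hi s.2 (νC s)
  haveI : ∀ s : {s : ConjClasses (quasiSplit F E c 2).arithmeticSubgroup // cl (rep s) = i},
      CompactSpace (↥(Subgroup.centralizer ({((rep s.1 : (quasiSplit F E c 2).arithmeticSubgroup) :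
        (quasiSplit F E c 2).Adelic)} : Set (quasiSplit F E c 2).Adelic)) ⧸
        ((quasiSplit F E c 2).quotientSubgroup ⊓ Subgroup.centralizer ({((rep s.1 : (quasiSplit F E c 2).arithmeticSubgroup) :
          (quasiSplit F E c 2).Adelic)} : Set (quasiSplit F E c 2).Adelic)).subgroupOf
          (Subgroup.centralizer ({((rep s.1 : (quasiSplit F E c 2).arithmeticSubgroup) : (quasiSplit F E c 2).Adelic)} :
            Set (quasiSplit F E c 2).Adelic))) := fun s =>
    compactSpace_centralizer_quotient_of_forall_cl_ne_two hcl hi s.2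
  -- the finiteness (★ `UnitaryGroupKernelClassEllipticFiniteTwo`), for the finite automorphic measure `μ`
  letI := AdelicGroupData.measurableSpaceQuotientForm (quasiSplit F E c 2)
  haveI := AdelicGroupData.isFiniteMeasureQuotientForm (quasiSplit F E c 2) μ
  have hfin : ∫⁻ x, conjTsum (quasiSplit F E c 2).quotientSubgroup
      (((↑) : (quasiSplit F E c 2).arithmeticSubgroup → (quasiSplit F E c 2).Adelic) '' (cl ⁻¹' {i}))
      (conj_mem_image_fiber hcl i) (fun g => (‖f g‖ₑ : ℝ≥0∞)) x ∂μ < ∞ :=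
    lintegral_conjTsum_fiber_enorm_lt_top_two hcl (fun β hβ => hi ⟨β, hβ⟩) (conj_mem_image_fiber hcl i)
      hf.continuous' hf.hasCompactSupport' μ
  exact truncatedTraceClass_eq_mul_tsum_covol_mul_orbitalIntegral_of_forall_ne μ ν hcl i rep hrep νC hi
    hf.continuous'.measurable hfin ν₀ 𝓕 T

end Measure

/-! ## §3 The CM pair `(L⁺, L, complexConj)` at `N = 2`: no hypothesis -/

/-- **THE ELLIPTIC TERMS OF THE COARSE GEOMETRIC EXPANSION FOR THE QUASI-SPLIT `U(J₂)` OF A CM FIELD ARE ORBITAL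
INTEGRALS** (Rogawski (1990), §2.3 p. 14 and p. 98; Arthur (1978), §8): for the CM pair `(L⁺, L, complexConj)`, a
conjugation-invariant class map `cl` on `G(L⁺)`, a class `i` with `cl β ≠ i` for every `β ∈ B(L⁺)`, an automorphic
measure `μ`, ANY Haar measure `ν` of `G(𝔸_{L⁺})` (two-sided: ★ `isMulRightInvariant_quasiSplit_cm_two`), a section
`rep` of the conjugacy classes, ANY Haar measures `ν_s` of the centralisers `G_{γ_s}(𝔸)` and a test function `f`:

  `J^T_𝔬(f) = c_μ · Σ'_{s ⊆ 𝔬} vol(G_{γ_s}(L⁺)\G_{γ_s}(𝔸_{L⁺})) · Φ_{ν/ν_s}(γ_s, f)`   for every `T`, `ν₀`, `𝓕`,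

with `c_μ = unfoldingConstant G(L⁺) count μ ν` and the covolume for `ν_s` and the counting measure — §2 with the
unimodularity of `U(J₂)(𝔸_{L⁺})` (★ `isMulRightInvariant_quasiSplit_cm_two`, H-B2). [cite: Rogawski1990, §2.2 (p. 13)] [cite: Arthur1978TraceFormulaI, §8]
[cite: Gelbart1975, (9.13) and Thm. 9.22 (ii)] -/
theorem truncatedTraceClass_eq_mul_tsum_covol_mul_orbitalIntegral_cm_two (L : Type) [Field L] [NumberField L] [IsCMField L]
    [MeasurableSpace (quasiSplit (↥(maximalRealSubfield L)) L (IsCMField.complexConj L) 2).Adelic]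
    [BorelSpace (quasiSplit (↥(maximalRealSubfield L)) L (IsCMField.complexConj L) 2).Adelic]
    [MeasurableSpace (adelicUnipotent (↥(maximalRealSubfield L)) L (IsCMField.complexConj L) 2)]
    [∀ γ : (quasiSplit (↥(maximalRealSubfield L)) L (IsCMField.complexConj L) 2).Adelic,
      MeasurableSpace ((quasiSplit (↥(maximalRealSubfield L)) L (IsCMField.complexConj L) 2).Adelic ⧸
        Subgroup.centralizer ({γ} : Set (quasiSplit (↥(maximalRealSubfield L)) L (IsCMField.complexConj L) 2).Adelic))]
    [∀ γ : (quasiSplit (↥(maximalRealSubfield L)) L (IsCMField.complexConj L) 2).Adelic,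
      BorelSpace ((quasiSplit (↥(maximalRealSubfield L)) L (IsCMField.complexConj L) 2).Adelic ⧸
        Subgroup.centralizer ({γ} : Set (quasiSplit (↥(maximalRealSubfield L)) L (IsCMField.complexConj L) 2).Adelic))]
    [∀ γ : (quasiSplit (↥(maximalRealSubfield L)) L (IsCMField.complexConj L) 2).Adelic,
      MeasurableSpace (↥(Subgroup.centralizer ({γ} : Set (quasiSplit (↥(maximalRealSubfield L)) L (IsCMField.complexConj L) 2).Adelic)) ⧸
        ((quasiSplit (↥(maximalRealSubfield L)) L (IsCMField.complexConj L) 2).quotientSubgroup ⊓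
          Subgroup.centralizer ({γ} : Set (quasiSplit (↥(maximalRealSubfield L)) L (IsCMField.complexConj L) 2).Adelic)).subgroupOf
          (Subgroup.centralizer ({γ} : Set (quasiSplit (↥(maximalRealSubfield L)) L (IsCMField.complexConj L) 2).Adelic)))]
    [∀ γ : (quasiSplit (↥(maximalRealSubfield L)) L (IsCMField.complexConj L) 2).Adelic,
      BorelSpace (↥(Subgroup.centralizer ({γ} : Set (quasiSplit (↥(maximalRealSubfield L)) L (IsCMField.complexConj L) 2).Adelic)) ⧸
        ((quasiSplit (↥(maximalRealSubfield L)) L (IsCMField.complexConj L) 2).quotientSubgroup ⊓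
          Subgroup.centralizer ({γ} : Set (quasiSplit (↥(maximalRealSubfield L)) L (IsCMField.complexConj L) 2).Adelic)).subgroupOf
          (Subgroup.centralizer ({γ} : Set (quasiSplit (↥(maximalRealSubfield L)) L (IsCMField.complexConj L) 2).Adelic)))]
    (μ : Measure (quasiSplit (↥(maximalRealSubfield L)) L (IsCMField.complexConj L) 2).automorphicQuotient)
    [(quasiSplit (↥(maximalRealSubfield L)) L (IsCMField.complexConj L) 2).IsAutomorphicMeasure μ]
    (ν : Measure (quasiSplit (↥(maximalRealSubfield L)) L (IsCMField.complexConj L) 2).Adelic) [IsHaarMeasure ν]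
    {ι : Type*} {cl : (quasiSplit (↥(maximalRealSubfield L)) L (IsCMField.complexConj L) 2).arithmeticSubgroup → ι}
    (hcl : IsConjInvariant cl) (i : ι)
    (rep : ConjClasses (quasiSplit (↥(maximalRealSubfield L)) L (IsCMField.complexConj L) 2).arithmeticSubgroup →
      (quasiSplit (↥(maximalRealSubfield L)) L (IsCMField.complexConj L) 2).arithmeticSubgroup)
    (hrep : ∀ s, ConjClasses.mk (rep s) = s)
    (νC : ∀ s : {s : ConjClasses (quasiSplit (↥(maximalRealSubfield L)) L (IsCMField.complexConj L) 2).arithmeticSubgroup // cl (rep s) = i},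
      Measure ↥(Subgroup.centralizer ({((rep s.1 : (quasiSplit (↥(maximalRealSubfield L)) L (IsCMField.complexConj L) 2).arithmeticSubgroup) :
        (quasiSplit (↥(maximalRealSubfield L)) L (IsCMField.complexConj L) 2).Adelic)} :
        Set (quasiSplit (↥(maximalRealSubfield L)) L (IsCMField.complexConj L) 2).Adelic)))
    [∀ s, IsHaarMeasure (νC s)]
    (hi : ∀ β : arithmeticBorel (↥(maximalRealSubfield L)) L (IsCMField.complexConj L) 2, cl β ≠ i)
    {f : (quasiSplit (↥(maximalRealSubfield L)) L (IsCMField.complexConj L) 2).Adelic → ℂ}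
    (hf : IsQuasiSplitTest (↥(maximalRealSubfield L)) L (IsCMField.complexConj L) 2 f)
    (ν₀ : Measure (adelicUnipotent (↥(maximalRealSubfield L)) L (IsCMField.complexConj L) 2))
    (𝓕 : Set (adelicUnipotent (↥(maximalRealSubfield L)) L (IsCMField.complexConj L) 2)) (T : ℝ≥0) :
    haveI := t2Space_quasiSplitAdelic (F := ↥(maximalRealSubfield L)) (E := L) (c := IsCMField.complexConj L) (N := 2)
    haveI := locallyCompactSpace_quasiSplitAdelic (F := ↥(maximalRealSubfield L)) (E := L) (c := IsCMField.complexConj L) (N := 2)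
    haveI := secondCountableTopology_quasiSplitAdelic (F := ↥(maximalRealSubfield L)) (E := L) (c := IsCMField.complexConj L) (N := 2)
    haveI : IsClosed (((quasiSplit (↥(maximalRealSubfield L)) L (IsCMField.complexConj L) 2).quotientSubgroup : Set (quasiSplit (↥(maximalRealSubfield L)) L (IsCMField.complexConj L) 2).Adelic)) :=
      isClosed_quotientSubgroup_quasiSplit
    haveI : ∀ γ : (quasiSplit (↥(maximalRealSubfield L)) L (IsCMField.complexConj L) 2).Adelic, IsClosed ((Subgroup.centralizer ({γ} : Set (quasiSplit (↥(maximalRealSubfield L)) L (IsCMField.complexConj L) 2).Adelic) :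
        Subgroup (quasiSplit (↥(maximalRealSubfield L)) L (IsCMField.complexConj L) 2).Adelic) : Set (quasiSplit (↥(maximalRealSubfield L)) L (IsCMField.complexConj L) 2).Adelic) := isClosed_centralizer_quasiSplit
    haveI : ∀ γ : (quasiSplit (↥(maximalRealSubfield L)) L (IsCMField.complexConj L) 2).Adelic, (count : Measure ↥(((quasiSplit (↥(maximalRealSubfield L)) L (IsCMField.complexConj L) 2).quotientSubgroup ⊓
        Subgroup.centralizer ({γ} : Set (quasiSplit (↥(maximalRealSubfield L)) L (IsCMField.complexConj L) 2).Adelic)).subgroupOf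
          (Subgroup.centralizer ({γ} : Set (quasiSplit (↥(maximalRealSubfield L)) L (IsCMField.complexConj L) 2).Adelic)))).IsHaarMeasure :=
      isHaarMeasure_count_inf_centralizer_subgroupOf_quasiSplit
    haveI : (count : Measure (quasiSplit (↥(maximalRealSubfield L)) L (IsCMField.complexConj L) 2).quotientSubgroup).IsHaarMeasure :=
      isHaarMeasure_count_quotientSubgroup_quasiSplit
    haveI : ν.IsMulRightInvariant := isMulRightInvariant_quasiSplit_cm_two L ν
    haveI : ∀ s : {s : ConjClasses (quasiSplit (↥(maximalRealSubfield L)) L (IsCMField.complexConj L) 2).arithmeticSubgroup // cl (rep s) = i},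
        (νC s).IsMulRightInvariant := fun s =>
      isMulRightInvariant_centralizer_of_forall_cl_ne_two hcl hi s.2 (νC s)
    haveI : ∀ s : {s : ConjClasses (quasiSplit (↥(maximalRealSubfield L)) L (IsCMField.complexConj L) 2).arithmeticSubgroup // cl (rep s) = i},
        (νC s).IsInvInvariant := fun s =>
      isInvInvariant_centralizer_of_forall_cl_ne_two hcl hi s.2 (νC s)
    letI := AdelicGroupData.measurableSpaceQuotientForm (quasiSplit (↥(maximalRealSubfield L)) L (IsCMField.complexConj L) 2)
    haveI := AdelicGroupData.borelSpaceQuotientForm (quasiSplit (↥(maximalRealSubfield L)) L (IsCMField.complexConj L) 2)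
    haveI := AdelicGroupData.smulInvariantMeasureQuotientForm (quasiSplit (↥(maximalRealSubfield L)) L (IsCMField.complexConj L) 2) μ
    haveI := AdelicGroupData.isFiniteMeasureOnCompactsQuotientForm (quasiSplit (↥(maximalRealSubfield L)) L (IsCMField.complexConj L) 2) μ
    truncatedTraceClass μ ν₀ 𝓕 T cl i f =
      ((unfoldingConstant (quasiSplit (↥(maximalRealSubfield L)) L (IsCMField.complexConj L) 2).quotientSubgroup
          (count : Measure (quasiSplit (↥(maximalRealSubfield L)) L (IsCMField.complexConj L) 2).quotientSubgroup) μ ν : ℝ) : ℂ) *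
        ∑' s : {s : ConjClasses (quasiSplit (↥(maximalRealSubfield L)) L (IsCMField.complexConj L) 2).arithmeticSubgroup // cl (rep s) = i},
          ((quotientMeasure (((quasiSplit (↥(maximalRealSubfield L)) L (IsCMField.complexConj L) 2).quotientSubgroup ⊓
              Subgroup.centralizer ({((rep s.1 : (quasiSplit (↥(maximalRealSubfield L)) L (IsCMField.complexConj L) 2).arithmeticSubgroup) :
                (quasiSplit (↥(maximalRealSubfield L)) L (IsCMField.complexConj L) 2).Adelic)} :
                Set (quasiSplit (↥(maximalRealSubfield L)) L (IsCMField.complexConj L) 2).Adelic)).subgroupOf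
              (Subgroup.centralizer ({((rep s.1 : (quasiSplit (↥(maximalRealSubfield L)) L (IsCMField.complexConj L) 2).arithmeticSubgroup) :
                (quasiSplit (↥(maximalRealSubfield L)) L (IsCMField.complexConj L) 2).Adelic)} :
                Set (quasiSplit (↥(maximalRealSubfield L)) L (IsCMField.complexConj L) 2).Adelic)))
              count (isClosed_inf_centralizer_subgroupOf_quasiSplit _) (νC s) Set.univ).toReal : ℂ) *
            orbitalIntegral ((rep s.1 : (quasiSplit (↥(maximalRealSubfield L)) L (IsCMField.complexConj L) 2).arithmeticSubgroup) :
                (quasiSplit (↥(maximalRealSubfield L)) L (IsCMField.complexConj L) 2).Adelic) f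
              (quotientMeasure (Subgroup.centralizer ({((rep s.1 : (quasiSplit (↥(maximalRealSubfield L)) L (IsCMField.complexConj L) 2).arithmeticSubgroup) :
                (quasiSplit (↥(maximalRealSubfield L)) L (IsCMField.complexConj L) 2).Adelic)} :
                Set (quasiSplit (↥(maximalRealSubfield L)) L (IsCMField.complexConj L) 2).Adelic)) (νC s)
                (isClosed_centralizer_quasiSplit _) ν) := by
  haveI : ν.IsMulRightInvariant := isMulRightInvariant_quasiSplit_cm_two L ν
  exact (truncatedTraceClass_eq_mul_tsum_covol_mul_orbitalIntegral_of_isQuasiSplitTest_two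
    μ ν hcl i rep hrep νC hi hf ν₀ 𝓕 T).2

end UnitaryGroup

end Literature.NumberTheory.Automorphic
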